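import Summits.QuantumFields.YangMills.Theorems.SandwichVariancePinchingScoreCalculus
import Literature.MathematicalPhysics.QuantumFieldTheory.Balaban1983to89.B14Eq328GaussianIBP

/-!
# Route `SandwichVariancePinching` — SCORE IDENTITIES: integration by parts against `e^{−A}` for
# affine vector fields (toolkit for the cruxes `QuadraticVarianceFloor` stmt-QuantumFields-28260 and
# `QuadraticVarianceCeiling` stmt-QuantumFields-28259)

For a `C²` potential `A` on `ℝⁿ` under the whitened sandwich (`0 ≤ δ < 1`) and an AFFINE field
`u(x) = Mx + m`, the score `G_u := ∂_u A − tr M` satisfies the Stein / integration-by-parts identity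

  (I1)  `∫ F · ∂_{u}A · e^{−A} = ∫ (∂_{u}F + tr M · F) · e^{−A}`

for every `C¹` observable `F` of polynomial growth (`integral_mul_fderiv_affine_mul_exp_neg`; the
constant-direction case `integral_fderiv_mul_mul_exp_neg` is Mathlib's whole-space integration by parts
`integral_mul_fderiv_eq_neg_fderiv_mul_of_integrable` through the tree's
`B14.Eq328GaussianIBP.integral_mul_mul_eq_integral_fderiv_mul`, with NO boundary terms: all products are
Lebesgue integrable by the Gaussian domination of `…ScoreCalculus`).  Also: the derivative, `C¹`-ness and
growth of the score `x ↦ ∂_{u(x)}A(x)` (`hasFDerivAt_fderiv_affine`, `exists_abs_fderiv_affine_le`,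
`exists_abs_fderiv_fderiv_affine_le`) consumed by the second-moment identity (I2) of the sibling file
`…ScoreSecondMoment`.  This is the planner's (ym-idea-3 g13, PROOF-PLANS §g13) "(I1)" made formal.

HONEST SCOPE.  Helper lemmas (free-hands work of the LEAD seat of crux stmt-QuantumFields-22884, cell
ym-idea-1) toward the SVP cruxes 28260/28259; nothing here proves either crux, `QuadraticCovarianceComparison`
(26240), the `LogConcaveChart` thesis, rung R2a or any summit statement; the Yang–Mills mass gap is NOT
proved by any of this.
-/

noncomputable section

namespace Summit.QuantumFields.YangMills.Theorems.SandwichVariancePinching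

open MeasureTheory Real Filter Topology

variable {n : ℕ}

/-! ## Integration by parts against `e^{-A}` (score identities) -/

/-- Product of two polynomial growth bounds. [folklore] -/
theorem abs_mul_le_growth {f g : (Fin n → ℝ) → ℝ} {Df Dg : ℝ} {kf kg : ℕ}
    (hf : ∀ x, |f x| ≤ Df * (1 + ‖x‖) ^ kf) (hg : ∀ x, |g x| ≤ Dg * (1 + ‖x‖) ^ kg) (x : Fin n → ℝ) :
    |f x * g x| ≤ Df * Dg * (1 + ‖x‖) ^ (kf + kg) := by
  rw [abs_mul, pow_add]
  have h := mul_le_mul (hf x) (hg x) (abs_nonneg _) ((abs_nonneg _).trans (hf x))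
  linarith [h]

/-- Raising the exponent of a growth bound. [folklore] -/
theorem growth_mono {f : (Fin n → ℝ) → ℝ} {D : ℝ} {k k' : ℕ} (hk : k ≤ k')
    (hf : ∀ x, |f x| ≤ D * (1 + ‖x‖) ^ k) (x : Fin n → ℝ) : |f x| ≤ D * (1 + ‖x‖) ^ k' := by
  have hD : 0 ≤ D := by
    have := (abs_nonneg _).trans (hf 0); simpa using this
  exact (hf x).trans (mul_le_mul_of_nonneg_left
    (pow_le_pow_right₀ (by linarith [norm_nonneg x]) hk) hD)

/-- A coordinate of an affine field grows at most linearly: `|(Mx + m)_j| ≤ C(1+‖x‖)`. [folklore] -/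
theorem exists_abs_affine_apply_le (M : Matrix (Fin n) (Fin n) ℝ) (m : Fin n → ℝ) (j : Fin n) :
    ∃ C : ℝ, 0 ≤ C ∧ ∀ x : Fin n → ℝ, |(M.mulVec x + m) j| ≤ C * (1 + ‖x‖) := by
  refine ⟨∑ k, |M j k| + |m j|, by positivity, fun x => ?_⟩
  have h1 : |(M.mulVec x) j| ≤ (∑ k, |M j k|) * ‖x‖ := by
    simp only [Matrix.mulVec, dotProduct]
    calc |∑ k, M j k * x k| ≤ ∑ k, |M j k * x k| := Finset.abs_sum_le_sum_abs _ _
      _ ≤ ∑ k, |M j k| * ‖x‖ := Finset.sum_le_sum fun k _ => by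
          rw [abs_mul]
          exact mul_le_mul_of_nonneg_left
            (by simpa [Real.norm_eq_abs] using norm_le_pi_norm x k) (abs_nonneg _)
      _ = (∑ k, |M j k|) * ‖x‖ := by rw [Finset.sum_mul]
  have hs : 0 ≤ ∑ k, |M j k| := Finset.sum_nonneg fun k _ => abs_nonneg _
  calc |(M.mulVec x + m) j| = |(M.mulVec x) j + m j| := by simp
    _ ≤ |(M.mulVec x) j| + |m j| := abs_add_le _ _
    _ ≤ (∑ k, |M j k|) * ‖x‖ + |m j| := by linarith
    _ ≤ (∑ k, |M j k| + |m j|) * (1 + ‖x‖) := by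
        nlinarith [norm_nonneg x, abs_nonneg (m j)]

/-- A continuous linear functional on `ℝⁿ` expands along the coordinate vectors:
`L v = ∑ j, v j · L(e_j)`. [folklore] -/
theorem clm_apply_eq_sum_single (L : (Fin n → ℝ) →L[ℝ] ℝ) (v : Fin n → ℝ) :
    L v = ∑ j, v j * L (Pi.single j 1) := by
  conv_lhs => rw [← Finset.univ_sum_single v]
  rw [map_sum]
  refine Finset.sum_congr rfl fun j _ => ?_
  have : Pi.single j (v j) = v j • (Pi.single j (1 : ℝ) : Fin n → ℝ) := by
    rw [← Pi.single_smul]; simp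
  rw [this, map_smul, smul_eq_mul]

/-- The coordinate `x ↦ (Mx + m)_j` is `C¹` with `∂_{e_i}(Mx+m)_j = M_{ji}`. [folklore] -/
theorem hasFDerivAt_affine_apply (M : Matrix (Fin n) (Fin n) ℝ) (m : Fin n → ℝ) (j : Fin n)
    (x : Fin n → ℝ) :
    ∃ L : (Fin n → ℝ) →L[ℝ] ℝ, HasFDerivAt (fun y : Fin n → ℝ => (M.mulVec y + m) j) L x ∧
      ∀ v, L v = (M.mulVec v) j := by
  obtain ⟨L, hL, hLv⟩ :=
    Literature.MathematicalPhysics.QuantumFieldTheory.Balaban1983to89.B14.Eq328GaussianIBP.hasFDerivAt_dotProduct_const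
      (M j) x
  refine ⟨L, ?_, fun v => ?_⟩
  · have e : (fun y : Fin n → ℝ => (M.mulVec y + m) j) = fun y => y ⬝ᵥ M j + m j := by
      funext y
      simp [Matrix.mulVec, dotProduct_comm]
    rw [e]
    exact hL.add_const _
  · rw [hLv]
    simp [Matrix.mulVec, dotProduct_comm]

/-- `x ↦ (Mx + m)_j` is `C¹`. [folklore] -/
theorem contDiff_affine_apply (M : Matrix (Fin n) (Fin n) ℝ) (m : Fin n → ℝ) (j : Fin n) :
    ContDiff ℝ 1 fun y : Fin n → ℝ => (M.mulVec y + m) j := by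
  have e : (fun y : Fin n → ℝ => (M.mulVec y + m) j) = fun y => (∑ k, M j k * y k) + m j := by
    funext y; simp [Matrix.mulVec, dotProduct]
  rw [e]
  exact (ContDiff.sum fun k _ => contDiff_const.mul (contDiff_apply ℝ ℝ k)).add contDiff_const

/-- **SCORE IDENTITY, constant direction** (integration by parts against `e^{−A}`, no boundary
terms): for a `C²` potential with the whitened sandwich (`0 ≤ δ < 1`) and a `C¹` function `G`
of polynomial growth (with polynomially growing `∂ᵤG`),
`∫ ∂ᵤA · G · e^{−A} = ∫ ∂ᵤG · e^{−A}`. [folklore] -/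
theorem integral_fderiv_mul_mul_exp_neg {A : (Fin n → ℝ) → ℝ} (hA : ContDiff ℝ 2 A) {δ : ℝ}
    (hδ : 0 ≤ δ) (hδ1 : δ < 1)
    (hsw : ∀ x h : Fin n → ℝ, (1 - δ) * (h ⬝ᵥ h) ≤ A (x + h) + A (x - h) - 2 * A x ∧
      A (x + h) + A (x - h) - 2 * A x ≤ (1 + δ) * (h ⬝ᵥ h))
    (u : Fin n → ℝ) {G : (Fin n → ℝ) → ℝ} (hG : ContDiff ℝ 1 G) {DG DG' : ℝ} {kG kG' : ℕ}
    (hkG : kG ≤ 6) (hkG' : kG' ≤ 8) (hGb : ∀ x, |G x| ≤ DG * (1 + ‖x‖) ^ kG)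
    (hG'b : ∀ x, |fderiv ℝ G x u| ≤ DG' * (1 + ‖x‖) ^ kG') :
    ∫ x, fderiv ℝ A x u * G x * exp (-A x) = ∫ x, fderiv ℝ G x u * exp (-A x) := by
  have hAc : Continuous A := hA.continuous
  have hAd : Differentiable ℝ A := hA.differentiable (by norm_num)
  obtain ⟨C, κ, _, hκ, hlb⟩ := exists_quadratic_lower_of_sandwich hAc hδ1 hsw
  obtain ⟨K, _, hK⟩ := exists_abs_fderiv_le_of_sandwich hA hδ hsw u
  have hρd : Differentiable ℝ fun x => exp (-A x) := hAd.neg.exp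
  have hρ' : ∀ v, fderiv ℝ (fun x => exp (-A x)) v u = -(fderiv ℝ A v u * exp (-A v)) := by
    intro v
    have h : HasFDerivAt (fun x => exp (-A x)) (exp (-A v) • (-fderiv ℝ A v)) v :=
      (hAd v).hasFDerivAt.neg.exp
    rw [h.fderiv]
    simp only [smul_apply, neg_apply, smul_eq_mul]
    ring
  refine Literature.MathematicalPhysics.QuantumFieldTheory.Balaban1983to89.B14.Eq328GaussianIBP.integral_mul_mul_eq_integral_fderiv_mul
    hρd hρ' (fun v => (hG.differentiable one_ne_zero v)) ?_ ?_ ?_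
  · -- `∂ᵤA · G · e^{−A}`
    have hb := abs_mul_le_growth hK hGb
    exact integrable_mul_exp_neg_of_growth hAc ((continuous_fderiv_apply_of_contDiff hA u).mul
      hG.continuous) hκ (by omega) hlb hb
  · exact integrable_mul_exp_neg_of_growth hAc ((hG.continuous_fderiv one_ne_zero).clm_apply
      continuous_const) hκ hkG' hlb hG'b
  · exact integrable_mul_exp_neg_of_growth hAc hG.continuous hκ (by omega) hlb hGb

/-- **SCORE IDENTITY, affine field** `u(x) = Mx + m`:
`∫ F · ∂_{u}A · e^{−A} = ∫ (∂_{u}F + tr M · F) · e^{−A}` for `C¹` `F` with `|F| ≲ (1+‖x‖)³` and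
`|∂_jF| ≲ (1+‖x‖)²`. [folklore] -/
theorem integral_mul_fderiv_affine_mul_exp_neg {A : (Fin n → ℝ) → ℝ} (hA : ContDiff ℝ 2 A)
    {δ : ℝ} (hδ : 0 ≤ δ) (hδ1 : δ < 1)
    (hsw : ∀ x h : Fin n → ℝ, (1 - δ) * (h ⬝ᵥ h) ≤ A (x + h) + A (x - h) - 2 * A x ∧
      A (x + h) + A (x - h) - 2 * A x ≤ (1 + δ) * (h ⬝ᵥ h))
    (M : Matrix (Fin n) (Fin n) ℝ) (m : Fin n → ℝ) {F : (Fin n → ℝ) → ℝ} (hF : ContDiff ℝ 1 F)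
    {DF DF' : ℝ} (hFb : ∀ x, |F x| ≤ DF * (1 + ‖x‖) ^ 3)
    (hF'b : ∀ x (j : Fin n), |fderiv ℝ F x (Pi.single j 1)| ≤ DF' * (1 + ‖x‖) ^ 2) :
    ∫ x, F x * fderiv ℝ A x (M.mulVec x + m) * exp (-A x) =
      ∫ x, (fderiv ℝ F x (M.mulVec x + m) + M.trace * F x) * exp (-A x) := by
  have hAc : Continuous A := hA.continuous
  obtain ⟨C, κ, _, hκ, hlb⟩ := exists_quadratic_lower_of_sandwich hAc hδ1 hsw
  -- coordinates of the field and their growth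
  have hc : ∀ j : Fin n, ∃ Cj : ℝ, 0 ≤ Cj ∧ ∀ x : Fin n → ℝ, |(M.mulVec x + m) j| ≤ Cj * (1 + ‖x‖) ^ 1 :=
    fun j => by simpa using exists_abs_affine_apply_le M m j
  choose Cc hCc0 hCc using hc
  -- the summands `G_j = F · (Mx+m)_j`
  set G : Fin n → (Fin n → ℝ) → ℝ := fun j x => F x * (M.mulVec x + m) j with hGdef
  have hGc : ∀ j, ContDiff ℝ 1 (G j) := fun j => hF.mul (contDiff_affine_apply M m j)
  have hGb : ∀ j x, |G j x| ≤ DF * Cc j * (1 + ‖x‖) ^ (3 + 1) := fun j x =>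
    abs_mul_le_growth hFb (hCc j) x
  -- derivative of `G_j` along `e_j`
  have hGd : ∀ j x, fderiv ℝ (G j) x (Pi.single j 1) =
      fderiv ℝ F x (Pi.single j 1) * (M.mulVec x + m) j + F x * M j j := by
    intro j x
    obtain ⟨L, hL, hLv⟩ := hasFDerivAt_affine_apply M m j x
    have hFd : HasFDerivAt F (fderiv ℝ F x) x := (hF.differentiable one_ne_zero x).hasFDerivAt
    have h : HasFDerivAt (fun y => F y * (M.mulVec y + m) j)
        (F x • L + (M.mulVec x + m) j • fderiv ℝ F x) x := hFd.mul hL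
    rw [show G j = fun y => F y * (M.mulVec y + m) j from rfl, h.fderiv]
    simp only [add_apply, smul_apply, smul_eq_mul, hLv, Matrix.mulVec_single_one, Matrix.col_apply]
    ring
  have hG'b : ∀ j x, |fderiv ℝ (G j) x (Pi.single j 1)| ≤ (DF' * Cc j + DF * |M j j|) * (1 + ‖x‖) ^ 3 := by
    intro j x
    rw [hGd]
    have h1 : |fderiv ℝ F x (Pi.single j 1) * (M.mulVec x + m) j| ≤ DF' * Cc j * (1 + ‖x‖) ^ (2 + 1) :=
      abs_mul_le_growth (fun y => hF'b y j) (hCc j) x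
    have h2 : |F x * M j j| ≤ DF * |M j j| * (1 + ‖x‖) ^ 3 := by
      rw [abs_mul]
      have := hFb x
      nlinarith [abs_nonneg (M j j), abs_nonneg (F x)]
    calc |fderiv ℝ F x (Pi.single j 1) * (M.mulVec x + m) j + F x * M j j|
        ≤ |fderiv ℝ F x (Pi.single j 1) * (M.mulVec x + m) j| + |F x * M j j| := abs_add_le _ _
      _ ≤ DF' * Cc j * (1 + ‖x‖) ^ (2 + 1) + DF * |M j j| * (1 + ‖x‖) ^ 3 := add_le_add h1 h2
      _ = (DF' * Cc j + DF * |M j j|) * (1 + ‖x‖) ^ 3 := by ring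
  -- the constant-direction identity for each `j`
  have hj : ∀ j, ∫ x, fderiv ℝ A x (Pi.single j 1) * G j x * exp (-A x) =
      ∫ x, fderiv ℝ (G j) x (Pi.single j 1) * exp (-A x) := fun j =>
    integral_fderiv_mul_mul_exp_neg hA hδ hδ1 hsw (Pi.single j 1) (hGc j) (by norm_num) (by norm_num)
      (hGb j) (hG'b j)
  -- integrability of the summands on both sides
  obtain ⟨K, _, hK⟩ : ∃ K : ℝ, 0 ≤ K ∧ ∀ (j : Fin n) x, |fderiv ℝ A x (Pi.single j 1)| ≤ K * (1 + ‖x‖) ^ 2 := by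
    have h := fun j : Fin n => exists_abs_fderiv_le_of_sandwich hA hδ hsw (Pi.single j 1)
    choose Kj hKj0 hKj using h
    refine ⟨∑ j, Kj j, Finset.sum_nonneg fun j _ => hKj0 j, fun j x => (hKj j x).trans ?_⟩
    exact mul_le_mul_of_nonneg_right (Finset.single_le_sum (fun i _ => hKj0 i) (Finset.mem_univ j))
      (by positivity)
  have hIL : ∀ j, Integrable fun x => fderiv ℝ A x (Pi.single j 1) * G j x * exp (-A x) := fun j =>
    integrable_mul_exp_neg_of_growth hAc ((continuous_fderiv_apply_of_contDiff hA _).mul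
      (hGc j).continuous) hκ (by norm_num : 2 + (3 + 1) ≤ 8) hlb (abs_mul_le_growth (hK j) (hGb j))
  have hIR : ∀ j, Integrable fun x => fderiv ℝ (G j) x (Pi.single j 1) * exp (-A x) := fun j =>
    integrable_mul_exp_neg_of_growth hAc (((hGc j).continuous_fderiv one_ne_zero).clm_apply
      continuous_const) hκ (by norm_num : 3 ≤ 8) hlb (hG'b j)
  -- rewrite both sides as sums over `j`
  have eL : (fun x => F x * fderiv ℝ A x (M.mulVec x + m) * exp (-A x)) =
      fun x => ∑ j, fderiv ℝ A x (Pi.single j 1) * G j x * exp (-A x) := by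
    funext x
    rw [clm_apply_eq_sum_single (fderiv ℝ A x) (M.mulVec x + m), Finset.mul_sum, Finset.sum_mul]
    refine Finset.sum_congr rfl fun j _ => ?_
    simp only [hGdef]; ring
  have eR : (fun x => (fderiv ℝ F x (M.mulVec x + m) + M.trace * F x) * exp (-A x)) =
      fun x => ∑ j, fderiv ℝ (G j) x (Pi.single j 1) * exp (-A x) := by
    funext x
    rw [clm_apply_eq_sum_single (fderiv ℝ F x) (M.mulVec x + m), Matrix.trace, ← Finset.sum_mul]
    simp only [Matrix.diag_apply, hGd]
    rw [Finset.sum_mul, Finset.sum_mul, ← Finset.sum_add_distrib, Finset.sum_mul]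
    refine Finset.sum_congr rfl fun j _ => ?_
    ring
  rw [eL, eR, integral_finsetSum _ (fun j _ => hIL j), integral_finsetSum _ (fun j _ => hIR j)]
  exact Finset.sum_congr rfl fun j _ => hj j


/-! ## The affine score `G_u = ∂_u A − tr M`: derivative, growth, second moment -/

/-- The affine field `x ↦ Mx + m` has derivative `v ↦ Mv`. [folklore] -/
theorem hasFDerivAt_affine (M : Matrix (Fin n) (Fin n) ℝ) (m x : Fin n → ℝ) :
    HasFDerivAt (fun y : Fin n → ℝ => M.mulVec y + m)
      (Matrix.mulVecLin M).toContinuousLinearMap x :=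
  ((Matrix.mulVecLin M).toContinuousLinearMap.hasFDerivAt).add_const m

/-- The affine field is smooth. [folklore] -/
theorem contDiff_affine (M : Matrix (Fin n) (Fin n) ℝ) (m : Fin n → ℝ) :
    ContDiff ℝ 1 fun y : Fin n → ℝ => M.mulVec y + m :=
  ((Matrix.mulVecLin M).toContinuousLinearMap.contDiff).add contDiff_const

/-- DERIVATIVE OF THE SCORE: `∂_v(∂_{u}A)(x) = ∂_{Mv}A(x) + D²A(x)(v, u(x))` for `u(x) = Mx + m`.
[folklore] -/
theorem hasFDerivAt_fderiv_affine {A : (Fin n → ℝ) → ℝ} (hA : ContDiff ℝ 2 A)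
    (M : Matrix (Fin n) (Fin n) ℝ) (m x : Fin n → ℝ) :
    ∃ L : (Fin n → ℝ) →L[ℝ] ℝ,
      HasFDerivAt (fun y : Fin n → ℝ => fderiv ℝ A y (M.mulVec y + m)) L x ∧
      ∀ v, L v = fderiv ℝ A x (M.mulVec v) + fderiv ℝ (fderiv ℝ A) x v (M.mulVec x + m) := by
  have hc : HasFDerivAt (fderiv ℝ A) (fderiv ℝ (fderiv ℝ A) x) x :=
    (((hA.fderiv_right (m := 1) (by norm_num)).differentiable (by norm_num)) x).hasFDerivAt
  have h := hc.clm_apply (hasFDerivAt_affine M m x)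
  refine ⟨_, h, fun v => ?_⟩
  simp only [add_apply, ContinuousLinearMap.comp_apply, ContinuousLinearMap.flip_apply]
  rfl

/-- The score `x ↦ ∂_{Mx+m}A(x)` is `C¹` for `A ∈ C²`. [folklore] -/
theorem contDiff_fderiv_affine {A : (Fin n → ℝ) → ℝ} (hA : ContDiff ℝ 2 A)
    (M : Matrix (Fin n) (Fin n) ℝ) (m : Fin n → ℝ) :
    ContDiff ℝ 1 fun y : Fin n → ℝ => fderiv ℝ A y (M.mulVec y + m) :=
  (hA.fderiv_right (m := 1) (by norm_num)).clm_apply (contDiff_affine M m)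

/-- The affine field has sup norm `‖Mx + m‖ ≤ C(1 + ‖x‖)`. [folklore] -/
theorem exists_norm_affine_le (M : Matrix (Fin n) (Fin n) ℝ) (m : Fin n → ℝ) :
    ∃ C : ℝ, 0 ≤ C ∧ ∀ x : Fin n → ℝ, ‖M.mulVec x + m‖ ≤ C * (1 + ‖x‖) := by
  have h := fun j : Fin n => exists_abs_affine_apply_le M m j
  choose Cj hCj0 hCj using h
  refine ⟨∑ j, Cj j, Finset.sum_nonneg fun j _ => hCj0 j, fun x => ?_⟩
  have hr : 0 ≤ 1 + ‖x‖ := by positivity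
  refine (pi_norm_le_iff_of_nonneg (mul_nonneg (Finset.sum_nonneg fun j _ => hCj0 j) hr)).mpr
    fun j => ?_
  rw [Real.norm_eq_abs]
  exact (hCj j x).trans (mul_le_mul_of_nonneg_right
    (Finset.single_le_sum (fun i _ => hCj0 i) (Finset.mem_univ j)) hr)

/-- GROWTH OF `∂_{u(x)}A(x)` for an affine field: degree `3`. [folklore] -/
theorem exists_abs_fderiv_affine_le {A : (Fin n → ℝ) → ℝ} (hA : ContDiff ℝ 2 A) {δ : ℝ}
    (hδ : 0 ≤ δ)
    (hsw : ∀ x h : Fin n → ℝ, (1 - δ) * (h ⬝ᵥ h) ≤ A (x + h) + A (x - h) - 2 * A x ∧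
      A (x + h) + A (x - h) - 2 * A x ≤ (1 + δ) * (h ⬝ᵥ h))
    (M : Matrix (Fin n) (Fin n) ℝ) (m : Fin n → ℝ) :
    ∃ D : ℝ, 0 ≤ D ∧ ∀ x, |fderiv ℝ A x (M.mulVec x + m)| ≤ D * (1 + ‖x‖) ^ 3 := by
  have h := fun j : Fin n => exists_abs_fderiv_le_of_sandwich hA hδ hsw (Pi.single j 1)
  choose Kj hKj0 hKj using h
  have hc := fun j : Fin n => exists_abs_affine_apply_le M m j
  choose Cj hCj0 hCj using hc
  refine ⟨∑ j, Cj j * Kj j, Finset.sum_nonneg fun j _ => mul_nonneg (hCj0 j) (hKj0 j), fun x => ?_⟩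
  rw [clm_apply_eq_sum_single, Finset.sum_mul]
  refine (Finset.abs_sum_le_sum_abs _ _).trans (Finset.sum_le_sum fun j _ => ?_)
  rw [abs_mul]
  calc |(M.mulVec x + m) j| * |fderiv ℝ A x (Pi.single j 1)|
      ≤ (Cj j * (1 + ‖x‖)) * (Kj j * (1 + ‖x‖) ^ 2) :=
        mul_le_mul (hCj j x) (hKj j x) (abs_nonneg _) (mul_nonneg (hCj0 j) (by positivity))
    _ = Cj j * Kj j * (1 + ‖x‖) ^ 3 := by ring

/-- GROWTH OF THE PARTIALS OF THE SCORE: `|∂_v ∂_{u}A(x)| ≤ D(1+‖x‖)²`. [folklore] -/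
theorem exists_abs_fderiv_fderiv_affine_le {A : (Fin n → ℝ) → ℝ} (hA : ContDiff ℝ 2 A) {δ : ℝ}
    (hδ : 0 ≤ δ)
    (hsw : ∀ x h : Fin n → ℝ, (1 - δ) * (h ⬝ᵥ h) ≤ A (x + h) + A (x - h) - 2 * A x ∧
      A (x + h) + A (x - h) - 2 * A x ≤ (1 + δ) * (h ⬝ᵥ h))
    (M : Matrix (Fin n) (Fin n) ℝ) (m v : Fin n → ℝ) :
    ∃ D : ℝ, 0 ≤ D ∧ ∀ x,
      |fderiv ℝ (fun y : Fin n → ℝ => fderiv ℝ A y (M.mulVec y + m)) x v| ≤ D * (1 + ‖x‖) ^ 2 := by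
  obtain ⟨K, hK0, hK⟩ := exists_abs_fderiv_le_of_sandwich hA hδ hsw (M.mulVec v)
  obtain ⟨C, hC0, hC⟩ := exists_norm_affine_le M m
  refine ⟨K + (1 + δ) / 2 * ((n : ℝ) * ‖v‖ ^ 2 + (n : ℝ) * C ^ 2), by positivity, fun x => ?_⟩
  obtain ⟨L, hL, hLv⟩ := hasFDerivAt_fderiv_affine hA M m x
  rw [hL.fderiv, hLv]
  have h1 := hK x
  have h2 := abs_fderiv_fderiv_le_norm hA hsw hδ x v (M.mulVec x + m)
  have h3 : ‖M.mulVec x + m‖ ^ 2 ≤ C ^ 2 * (1 + ‖x‖) ^ 2 := by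
    rw [← mul_pow]; exact pow_le_pow_left₀ (norm_nonneg _) (hC x) 2
  have h4 : (1 : ℝ) ≤ (1 + ‖x‖) ^ 2 := by nlinarith [norm_nonneg x]
  have hn : (0:ℝ) ≤ n := Nat.cast_nonneg n
  calc |fderiv ℝ A x (M.mulVec v) + fderiv ℝ (fderiv ℝ A) x v (M.mulVec x + m)|
      ≤ |fderiv ℝ A x (M.mulVec v)| + |fderiv ℝ (fderiv ℝ A) x v (M.mulVec x + m)| := abs_add_le _ _
    _ ≤ K * (1 + ‖x‖) ^ 2 + (1 + δ) / 2 * ((n : ℝ) * ‖v‖ ^ 2 + (n : ℝ) * ‖M.mulVec x + m‖ ^ 2) :=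
        add_le_add h1 h2
    _ ≤ K * (1 + ‖x‖) ^ 2 +
        (1 + δ) / 2 * ((n : ℝ) * ‖v‖ ^ 2 * (1 + ‖x‖) ^ 2 + (n : ℝ) * (C ^ 2 * (1 + ‖x‖) ^ 2)) := by
        have ha : (n : ℝ) * ‖v‖ ^ 2 ≤ (n : ℝ) * ‖v‖ ^ 2 * (1 + ‖x‖) ^ 2 :=
          le_mul_of_one_le_right (by positivity) h4
        have hb : (n : ℝ) * ‖M.mulVec x + m‖ ^ 2 ≤ (n : ℝ) * (C ^ 2 * (1 + ‖x‖) ^ 2) :=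
          mul_le_mul_of_nonneg_left h3 hn
        have hd : 0 ≤ (1 + δ) / 2 := by positivity
        linarith [mul_le_mul_of_nonneg_left (add_le_add ha hb) hd]
    _ = (K + (1 + δ) / 2 * ((n : ℝ) * ‖v‖ ^ 2 + (n : ℝ) * C ^ 2)) * (1 + ‖x‖) ^ 2 := by ring

end Summit.QuantumFields.YangMills.Theorems.SandwichVariancePinching

end
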